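import Literature.Algebra.EuclideanLattices.BabaiNearestPlane
import HarnessLib

/-!
# Babai's nearest-plane algorithm is equivariant under lattice shifts: its residual is a function of the coset

Topic `Algebra/EuclideanLattices` (family `pqc`), sequel of `BabaiNearestPlane.lean` (`Babai.nearestPlane k f c`,
the deterministic nearest-plane recursion on coefficient vectors, with the exact-recovery guarantee
`nearestPlane_vecOf_add`). Everything here is PROVED; one definition with body (`Babai.residual`).

Why: in the first component of Peikert's classical `GapSVP → LWE` reduction (STOC 2009, proof of
Thm. 3.1; hypothesis `h₁` of
`Literature.Computability.Cryptography.peikert_gapSVPZeta_to_lwe_classical_of_components`,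
`Cryptography/PeikertReduction.lean`, pqc.S20) the BDD instance handed to the oracle is
`x = w mod B` — ANY reduction of the perturbation `w` modulo the lattice `L(B)` that (i) differs from
`w` by a lattice vector (NO case: the closest vector to `x` is `x - w`, `Peikert2009.no_case`) and
(ii) depends on `w` only through its coset `w + L(B)` (YES case: the view of the solver is invariant
under the shift by a shortest vector, `Peikert2009.prob_names_perturbation_le`, hypothesis `hred`). The
tree's `Peikert2009.reduceMod` (`PeikertScaling.lean`, via `ZSpan.fract`) has both properties but needs
`B⁻¹`; the RESIDUAL of Babai's nearest-plane algorithm has both properties as well and is computed by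
exact integer arithmetic and roundings from the integral Gram–Schmidt data (Cohen's table,
`GramSchmidtTableLists.lean`), which is why the machine of `h₁` uses it. This file proves (i), (ii):

* `Babai.nearestPlane_vecOf_add_eq` — **shift equivariance**: `nearestPlane f (∑ aᵢbᵢ + c) = a + nearestPlane f c`
  for every integer vector `a` (all `b̃ᵢ ≠ 0`); the exact-recovery theorem of the tree is the case where
  the residual centres of `c = e` all round to `0`. Proof: the last centre of `∑ aᵢbᵢ + c` is
  `a_last + ⟪c, b̃_last⟫/‖b̃_last‖²` (`lastCenter_vecOf_add`) and `⌊m + t⌉ = m + ⌊t⌉` for `m ∈ ℤ`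
  (`round_intCast_add`); recurse on the prefix family (same Gram–Schmidt vectors).
* `Babai.residual k f c = c - ∑ (nearestPlane f c)ᵢ bᵢ` — the residual; `sub_residual_mem_span`
  ((i): `c - residual c ∈ L(f)`), `residual_vecOf_add` / **`residual_add_of_mem_span`** ((ii):
  `residual (z + c) = residual c` for `z ∈ L(f)`), `residual_eq_of_sub_mem_span`; `vecOf_add`,
  `vecOf_surjective_span` (every lattice vector is some `∑ aᵢbᵢ`).

## References

* L. Babai, *On Lovász' lattice reduction and the nearest lattice point problem*, Combinatorica 6
  (1986) 1–13, §3 (procedure NEAREST PLANE) [Babai1986].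
* C. Peikert, *Public-key cryptosystems from the worst-case shortest vector problem*, STOC 2009,
  proof of Thm. 3.1 ("`x = w mod B`") [Peikert2009].
-/

noncomputable section

open Finset InnerProductSpace Real
open scoped RealInnerProductSpace

namespace Literature.Algebra.EuclideanLattices

variable {V : Type*} [NormedAddCommGroup V] [InnerProductSpace ℝ V]

namespace Babai

open GPVSampler

/-! ### `vecOf` is additive and onto the lattice -/

/-- `∑ (a + z)ᵢ bᵢ = ∑ aᵢbᵢ + ∑ zᵢbᵢ`. [folklore] -/
theorem vecOf_add {k : ℕ} (f : Fin k → V) (a z : Fin k → ℤ) : vecOf f (a + z) = vecOf f a + vecOf f z := by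
  simp only [vecOf, Pi.add_apply, Int.cast_add, add_smul, sum_add_distrib]

/-- Every vector of the lattice `L(f) = span_ℤ f` is `∑ aᵢbᵢ` for some integer vector `a`. [folklore] -/
theorem vecOf_surjective_span {k : ℕ} (f : Fin k → V) {z : V} (hz : z ∈ Submodule.span ℤ (Set.range f)) :
    ∃ a : Fin k → ℤ, vecOf f a = z := by
  obtain ⟨a, ha⟩ := (Submodule.mem_span_range_iff_exists_fun ℤ).1 hz
  refine ⟨a, ?_⟩
  rw [← ha, vecOf]
  exact sum_congr rfl fun i _ => Int.cast_smul_eq_zsmul ℝ (a i) (f i)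

/-! ### Shift equivariance of the nearest-plane coefficients -/

/-- **Babai's nearest-plane algorithm is equivariant under lattice shifts**: for every integer vector
`a` and every target `c`, `nearestPlane f (∑ aᵢbᵢ + c) = a + nearestPlane f c` (all `b̃ᵢ ≠ 0`). The last
centre of `∑ aᵢbᵢ + c` is `a_last + ⟪c, b̃_last⟫/‖b̃_last‖²`, which rounds to `a_last + ⌊c'_last⌉`; the
recursive call sees `∑_{i<last} aᵢbᵢ + (c - ⌊c'_last⌉ b_last)` and the prefix family, whose
Gram–Schmidt vectors are the same. [cite: Babai1986, §3 (nearest plane procedure)] -/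
theorem nearestPlane_vecOf_add_eq : ∀ (k : ℕ) (f : Fin k → V) (_ : ∀ i, gramSchmidt ℝ f i ≠ 0)
    (a : Fin k → ℤ) (c : V), nearestPlane k f (vecOf f a + c) = a + nearestPlane k f c
  | 0, f, _, a, c => funext fun i => i.elim0
  | k + 1, f, hf, a, c => by
      have hfl := hf (Fin.last k)
      -- the last coefficient
      have hround : round (lastCenter f (vecOf f a + c)) = a (Fin.last k) + round (lastCenter f c) := by
        rw [lastCenter_vecOf_add f a c hfl, round_intCast_add, lastCenter]
      -- the recursive call
      have hprefix : ∀ i : Fin k, gramSchmidt ℝ (f ∘ Fin.castSucc) i = gramSchmidt ℝ f (Fin.castSucc i) :=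
        fun i => Literature.Analysis.InnerProduct.gramSchmidt_comp_castSucc ℝ f i
      have hf' : ∀ i : Fin k, gramSchmidt ℝ (f ∘ Fin.castSucc) i ≠ 0 := fun i => by
        rw [hprefix]; exact hf _
      have hrec : vecOf f a + c - ((a (Fin.last k) + round (lastCenter f c) : ℤ) : ℝ) • f (Fin.last k) =
          vecOf (f ∘ Fin.castSucc) (Fin.init a) + (c - (round (lastCenter f c) : ℝ) • f (Fin.last k)) := by
        rw [vecOf_succ, Int.cast_add, add_smul]
        abel
      rw [nearestPlane_succ, hround, hrec,
        nearestPlane_vecOf_add_eq k (f ∘ Fin.castSucc) hf' (Fin.init a) _, nearestPlane_succ f c]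
      funext i
      refine Fin.lastCases ?_ (fun j => ?_) i
      · simp [Fin.snoc_last]
      · simp [Fin.snoc_castSucc, Fin.init]

/-! ### The residual -/

/-- **The nearest-plane residual** `c - ∑ (nearestPlane f c)ᵢ bᵢ`: the target reduced modulo the lattice
`L(f)` by Babai's algorithm (`x = w mod B` of Peikert's reduction, realised without inverting `B`).
[cite: Babai1986, §3] -/
def residual (k : ℕ) (f : Fin k → V) (c : V) : V := c - vecOf f (nearestPlane k f c)

/-- Unfolding the residual. [folklore] -/
theorem residual_def (k : ℕ) (f : Fin k → V) (c : V) : residual k f c = c - vecOf f (nearestPlane k f c) := rfl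

/-- **(i) The residual differs from the target by a lattice vector**: `c - residual c ∈ L(f)`.
[cite: Babai1986, §3] -/
theorem sub_residual_mem_span (k : ℕ) (f : Fin k → V) (c : V) :
    c - residual k f c ∈ Submodule.span ℤ (Set.range f) := by
  rw [residual, sub_sub_cancel]
  exact vecOf_mem_span f _

/-- The residual itself lies in the coset: `residual c - c ∈ L(f)`. [folklore] -/
theorem residual_sub_mem_span (k : ℕ) (f : Fin k → V) (c : V) :
    residual k f c - c ∈ Submodule.span ℤ (Set.range f) := by
  rw [← neg_sub]
  exact Submodule.neg_mem _ (sub_residual_mem_span k f c)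

/-- **(ii) The residual is invariant under lattice shifts of the target** (coefficient form):
`residual (∑ aᵢbᵢ + c) = residual c` (all `b̃ᵢ ≠ 0`). [cite: Babai1986, §3] -/
theorem residual_vecOf_add (k : ℕ) (f : Fin k → V) (hf : ∀ i, gramSchmidt ℝ f i ≠ 0) (a : Fin k → ℤ)
    (c : V) : residual k f (vecOf f a + c) = residual k f c := by
  rw [residual, residual, nearestPlane_vecOf_add_eq k f hf a c, vecOf_add]
  abel

/-- **(ii) The residual is invariant under lattice shifts of the target**: `residual (z + c) = residual c`
for every `z ∈ L(f)` — the view `w ↦ residual w` of a perturbation depends on `w` only through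
`w + L(f)`. [cite: Babai1986, §3; Peikert2009, Thm. 3.1 (proof, `x = w mod B`)] -/
theorem residual_add_of_mem_span (k : ℕ) (f : Fin k → V) (hf : ∀ i, gramSchmidt ℝ f i ≠ 0) {z : V}
    (hz : z ∈ Submodule.span ℤ (Set.range f)) (c : V) : residual k f (z + c) = residual k f c := by
  obtain ⟨a, rfl⟩ := vecOf_surjective_span f hz
  exact residual_vecOf_add k f hf a c

/-- Two targets in the same coset have the same residual. [cite: Babai1986, §3] -/
theorem residual_eq_of_sub_mem_span (k : ℕ) (f : Fin k → V) (hf : ∀ i, gramSchmidt ℝ f i ≠ 0)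
    {c c' : V} (h : c' - c ∈ Submodule.span ℤ (Set.range f)) : residual k f c' = residual k f c := by
  have := residual_add_of_mem_span k f hf h c
  rwa [sub_add_cancel] at this

/-- For a linearly independent family all Gram–Schmidt vectors are nonzero, so (ii) holds for every
`ℤ`-basis of a lattice. [folklore] -/
theorem residual_add_of_mem_span' (k : ℕ) (f : Fin k → V) (hf : LinearIndependent ℝ f) {z : V}
    (hz : z ∈ Submodule.span ℤ (Set.range f)) (c : V) : residual k f (z + c) = residual k f c :=
  residual_add_of_mem_span k f (fun i => gramSchmidt_ne_zero i hf) hz c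

end Babai

end Literature.Algebra.EuclideanLattices

end
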